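import Summits.Ventures.CertifiedManyBodySolver.Downfold.EmeryFermiFaceVelocity
import Summits.Ventures.CertifiedManyBodySolver.Downfold.EmeryAxialFermiSurfaceShape
import HarnessLib

/-!
# The one-band `t–t′` FORM DEFECT of the bilinear secular family (σ three-band ± O–O ± energy-dependent axial
# channel), EXACTLY: `1 + δ = ∂_ε F(antinode)/∂_ε F(node)`; the axial channel is invisible at the node; at fixed
# Fermi surface the four-orbital form defect is LINEAR in one coordinate the Fermi surface cannot see

Venture CertifiedManyBodySolver, cell `pub/hubbard-downfold` (stage S1, HUMAN RULINGS D-0096/D-0098: the three-band → one-band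
reduction error is carried explicitly), seat hubbard-downfold-mod-4 (technique B); namespace
`Summit.Ventures.CertifiedManyBodySolver.Downfold.Emery`. Everything here is PROVED (exact algebra + two chain rules). WHAT THIS IS
NOT: a statement about any material (no number lives here); `U = 0` one-body kinematics; which Cu-site channel a material has is NOT
decided here.

SETTING. `OneBandInPlaneFormDefect` (the direct one-band side) defined, from a nodal Fermi point `(k_n, k_n)` and an antinodal one
`(π, k_a)` of a band and its two Fermi velocities, the node- and antinode-matched nearest-neighbour scales `t_node`, `t_an` of the UNIQUE
`t–t′` contour through both points and the FORM DEFECT `1 + δ = t_node/t_an`. `EmeryFermiSurfaceShape` / `EmeryAxialFermiSurfaceShape`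
proved that every constant-energy contour of the σ three-band model (with `t_pp`, `t_pp′`) and of the four-orbital (+ Cu 4s) model is
EXACTLY a `t–t′` contour. This file is the VELOCITY side of that theorem for the whole family at once.

* §1 THE BILINEAR SECULAR FAMILY `secBilin A D N x y = A − 4D(x + y) − 16N·xy` (`x = sin²(kx/2)`, `y = sin²(ky/2)`): the σ cubic
  (`charCubic_eq_secBilin`), its energy derivative (`dcharCubic_eq_secBilin`), the axial coefficient (`axialLin_eq_secBilin`) and the
  four-orbital secular function with ENERGY-DEPENDENT admixture `a(ε) = T/(ε_s − ε)`, `T = t_sp²`, cleared of its pole: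
  `sec4 = (ε_s − ε)·charCubic + T·axialLin = −det(H₄ − ε)` (`sec4_eq_neg_det`, `sec4_eq_secBilin`) are members; ON a contour a second
  member (e.g. the ε-derivative) is AFFINE in `s = x + y` (`secBilin_on_contour_affine`; the σ case is `EmeryFermiVelocityScale`'s
  `dcharA + dcharB·s`).
* §2 GRADIENT AND IMPLICIT VELOCITY. `|∇_k secBilin|² = (D + 2N)²·ttpGradSqUV ρ (cos kx) (cos ky)` with `ρ = −N/(D + 2N)` EVERYWHERE
  (`secGradSq_eq`): the k-gradient of any member is that of the `t–t′` band `(t, t′) = (D + 2N, −N)`. For ANY differentiable band branch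
  `e(k)` of ANY model whose secular function is `secBilin (A ε) (D ε) (N ε)` with differentiable coefficients, the chain rule gives
  `e′·W = (4D + 16N·y)·sin(kx/2)cos(kx/2)` along `kx` (`branch_velocity_kx`, and `_ky`), `W = secBilin A′ D′ N′ x y` the ENERGY
  DERIVATIVE of the secular function: velocity = (`t–t′` gradient)/`W`.
* §3 THE FORM-DEFECT LAW (`formDefect_law`): node `u = cos k_n` and antinode `v = cos k_a` on one contour ⇒ the osculating shape IS the
  contour shape (`ttpRho_eq_secRho`), `t_node = |D + 2N|/|W_node|`, `t_an = |D + 2N|/|W_an|`, hence **`t_node²·W_node² = t_an²·W_an²`**: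
  `1 + δ = |W_an/W_node|` — the one-band form defect of every member is the node/antinode ANISOTROPY OF THE ENERGY DERIVATIVE of its
  secular function, nothing else (for σ: `EmeryFermiVelocityScaleCheck`'s faithfulness factor `φ`).
* §4 σ INSTANCE: `HasDerivAt (charCubic … ε) (dcharCubic … ε)` (`hasDerivAt_charCubic_eps`) — the Taylor coefficient of
  `EmeryFermiSurfaceShapeBox` IS the derivative.
* §5–§6 (four-orbital instance with ENERGY-DEPENDENT admixture, fixed-Fermi-surface reduction, nodal invisibility of the axial
  channel, the one-parameter linear law) are in the companion file `EmerySecularFormDefectAxial`.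

Sources: three-band model [HybertsenSchluterChristensen1989, Eq. (1)]; four-orbital model, energy-dependent axial channel («ṡ/ḋ»,
`r ↦ r′`) and the `t, t′, t″` language [AndersenEtAl1995, §6–§7, Eqs. (17)–(21)]; [PavariniEtAl2001, Eqs. (1)–(3)].
-/

noncomputable section

namespace Summit.Ventures.CertifiedManyBodySolver.Downfold.Emery

open Real

/-! ## §1 The bilinear secular family -/

/-- A bilinear secular function in the half-angle variables: `A − 4D(x + y) − 16N·xy`. [cite: AndersenEtAl1995, §6] -/
def secBilin (A D N x y : ℝ) : ℝ := A - 4 * D * (x + y) - 16 * N * (x * y)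

/-- `secBilin` is symmetric in `(x, y)`. [folklore] -/
theorem secBilin_comm (A D N x y : ℝ) : secBilin A D N x y = secBilin A D N y x := by
  unfold secBilin; ring

/-- The σ secular cubic is the member `(cA, fsD, fsN)`. [cite: HybertsenSchluterChristensen1989, Eq. (1)] -/
theorem charCubic_eq_secBilin (Δ tpd tpp c x y ε : ℝ) :
    charCubic Δ tpd tpp c x y ε = secBilin (cA Δ ε) (fsD Δ tpd c ε) (fsN tpd tpp c ε) x y := by
  rw [charCubic_bilinear]; rfl

/-- Its energy Taylor coefficient is the member `(dcA, dfsD, dfsN)`. [folklore] -/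
theorem dcharCubic_eq_secBilin (Δ tpd tpp c x y ε : ℝ) :
    dcharCubic Δ tpd tpp c x y ε = secBilin (dcA Δ ε) (dfsD Δ tpd c ε) (dfsN tpp c) x y := by
  unfold dcharCubic secBilin; ring

/-- The axial co-shift coefficient is the member `(0, −fsD1, fsN1)`: `axialLin = 4fsD1(x + y) − 16fsN1·xy`. [folklore] -/
theorem axialLin_eq_secBilin (Δ tpd tpp c x y ε : ℝ) :
    axialLin Δ tpd tpp c x y ε = secBilin 0 (-fsD1 Δ ε) (fsN1 tpd tpp c ε) x y := by
  unfold axialLin secBilin fsD1 fsN1; ring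

/-- On a contour of the member `(A, D, N)` (`N ≠ 0`) the product `xy` is eliminated: `16N·xy = A − 4D(x + y)`. [folklore] -/
theorem secBilin_xy_of_contour {A D N x y : ℝ} (hP : secBilin A D N x y = 0) :
    16 * N * (x * y) = A - 4 * D * (x + y) := by
  unfold secBilin at hP; linarith

/-- Constant coefficient of a second member `(A′, D′, N′)` restricted to the contour of `(A, D, N)`: `A′ − N′A/N`. [folklore] -/
def secWA (A N A' N' : ℝ) : ℝ := A' - N' * A / N

/-- Slope in `s = x + y` of a second member restricted to the contour of `(A, D, N)`: `4DN′/N − 4D′`. [folklore] -/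
def secWB (D N D' N' : ℝ) : ℝ := 4 * D * N' / N - 4 * D'

/-- ON THE CONTOUR of `(A, D, N)` (`N ≠ 0`) every member `(A′, D′, N′)` is AFFINE in `s = x + y`:
`secBilin A′ D′ N′ = secWA + secWB·(x + y)`. [cite: AndersenEtAl1995, §6] -/
theorem secBilin_on_contour_affine {A D N x y : ℝ} (A' D' N' : ℝ) (hN : N ≠ 0) (hP : secBilin A D N x y = 0) :
    secBilin A' D' N' x y = secWA A N A' N' + secWB D N D' N' * (x + y) := by
  have hxy : x * y = (A - 4 * D * (x + y)) / (16 * N) := by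
    rw [eq_div_iff (by positivity)]
    have := secBilin_xy_of_contour hP
    linarith
  unfold secBilin secWA secWB
  rw [hxy]
  field_simp
  ring

/-- The four-orbital secular function with ENERGY-DEPENDENT axial admixture `a(ε) = T/(ε_s − ε)` cleared of its pole:
`sec4 = (ε_s − ε)·charCubic + T·axialLin` (`T = t_sp²`). [cite: AndersenEtAl1995, Eqs. (2), (5)] -/
def sec4 (Δ εs tpd tpp c T x y ε : ℝ) : ℝ :=
  (εs - ε) * charCubic Δ tpd tpp c x y ε + T * axialLin Δ tpd tpp c x y ε

/-- `sec4` with `T = t_sp²` is minus the four-orbital characteristic determinant (`EmeryAxialFermiSurfaceShape.det_fourBandPP_sub`).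
[cite: AndersenEtAl1995, Eqs. (2), (5)] -/
theorem sec4_eq_neg_det (Δ εs tpd tpp c tsp sx sy ε : ℝ) :
    sec4 Δ εs tpd tpp c (tsp ^ 2) (sx ^ 2) (sy ^ 2) ε =
      -(fourBandPP Δ εs tpd tpp c tsp sx sy - ε • (1 : Matrix (Fin 4) (Fin 4) ℝ)).det := by
  rw [det_fourBandPP_sub, neg_neg, sec4]

/-- Constant coefficient of `sec4`: `(ε_s − ε)·cA`. [folklore] -/
def secA4 (Δ εs ε : ℝ) : ℝ := (εs - ε) * cA Δ ε
/-- Nearest-neighbour coefficient of `sec4`: `(ε_s − ε)·fsD − T·fsD1`. [folklore] -/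
def secD4 (Δ εs tpd c T ε : ℝ) : ℝ := (εs - ε) * fsD Δ tpd c ε - T * fsD1 Δ ε
/-- Diagonal coefficient of `sec4`: `(ε_s − ε)·fsN + T·fsN1`. [folklore] -/
def secN4 (εs tpd tpp c T ε : ℝ) : ℝ := (εs - ε) * fsN tpd tpp c ε + T * fsN1 tpd tpp c ε

/-- `sec4` is the member `(secA4, secD4, secN4)` — bilinear in `(x, y)` with POLYNOMIAL coefficients in `ε`. [folklore] -/
theorem sec4_eq_secBilin (Δ εs tpd tpp c T x y ε : ℝ) :
    sec4 Δ εs tpd tpp c T x y ε = secBilin (secA4 Δ εs ε) (secD4 Δ εs tpd c T ε) (secN4 εs tpd tpp c T ε) x y := by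
  unfold sec4 secA4 secD4 secN4 secBilin
  rw [charCubic_bilinear, axialLin_eq_secBilin]
  unfold secBilin; ring

/-! ## §2 Gradient structure and the implicit (branch) velocity -/

/-- The contour scale `D + 2N` of a member (its `t–t′` nearest-neighbour hopping, conventional scale). [folklore] -/
def secT (D N : ℝ) : ℝ := D + 2 * N

/-- The contour shape `ρ = −N/(D + 2N)` of a member (its `t′/t`; for σ this is `fsRatio`). [folklore] -/
def secRho (D N : ℝ) : ℝ := -N / (D + 2 * N)

/-- For σ, `secRho fsD fsN = fsRatio`. [folklore] -/
theorem secRho_sigma (Δ tpd tpp c ε : ℝ) : secRho (fsD Δ tpd c ε) (fsN tpd tpp c ε) = fsRatio Δ tpd tpp c ε := rfl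

/-- `(D + 2N)·ρ = −N` for `ρ = secRho D N`. [folklore] -/
theorem secT_mul_secRho {D N : ℝ} (hT : D + 2 * N ≠ 0) : (D + 2 * N) * secRho D N = -N := by
  unfold secRho; field_simp

/-- In cosines `cx = 1 − 2x`, `cy = 1 − 2y` a member is `(A − 4D − 4N) − (D + 2N)·ttpUV ρ cx cy`: the `t–t′` band of shape `ρ`, up to
scale and offset (the contour theorem for the whole family). [cite: AndersenEtAl1995, §6] -/
theorem secBilin_eq_ttpUV {D N : ℝ} (A x y : ℝ) (hT : D + 2 * N ≠ 0) :
    secBilin A D N x y = (A - 4 * D - 4 * N) - (D + 2 * N) * ttpUV (secRho D N) (1 - 2 * x) (1 - 2 * y) := by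
  have h := secT_mul_secRho hT
  have e : (D + 2 * N) * ttpUV (secRho D N) (1 - 2 * x) (1 - 2 * y)
      = -2 * (D + 2 * N) * ((1 - 2 * x) + (1 - 2 * y)) - 4 * ((D + 2 * N) * secRho D N) * ((1 - 2 * x) * (1 - 2 * y)) := by
    unfold ttpUV; ring
  rw [e, h]
  unfold secBilin; ring

/-- `∂ secBilin/∂x = −(4D + 16N·y)`. [folklore] -/
theorem hasDerivAt_secBilin_x (A D N y x : ℝ) :
    HasDerivAt (fun x' => secBilin A D N x' y) (-(4 * D + 16 * N * y)) x := by
  have h : (fun x' => secBilin A D N x' y) = fun x' => (A - 4 * D * y) + (-(4 * D + 16 * N * y)) * x' := by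
    funext x'; unfold secBilin; ring
  rw [h]
  exact (((hasDerivAt_id' x).const_mul _).const_add _).congr_deriv (by ring)

/-- CHAIN RULE along `kx`: `d/dkx secBilin(sin²(kx/2), y) = −(4D + 16N·y)·sin(kx/2)cos(kx/2)`. [folklore] -/
theorem hasDerivAt_secBilin_kx (A D N y kx : ℝ) :
    HasDerivAt (fun k => secBilin A D N (Real.sin (k / 2) ^ 2) y)
      (-(4 * D + 16 * N * y) * (Real.sin (kx / 2) * Real.cos (kx / 2))) kx := by
  have := (hasDerivAt_secBilin_x A D N y (Real.sin (kx / 2) ^ 2)).comp kx (hasDerivAt_halfSq' kx)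
  simpa [Function.comp_def] using this

/-- The gradient factor in cosines: `4D + 16N·y = 4(D + 2N)·(1 + 2ρ·cy)` with `y = (1 − cy)/2`, `ρ = secRho`. [folklore] -/
theorem gradFactor_eq {D N : ℝ} (cy : ℝ) (hT : D + 2 * N ≠ 0) :
    4 * D + 16 * N * ((1 - cy) / 2) = 4 * (D + 2 * N) * (1 + 2 * secRho D N * cy) := by
  have h := secT_mul_secRho hT
  have e : 4 * (D + 2 * N) * (1 + 2 * secRho D N * cy) = 4 * (D + 2 * N) + 8 * ((D + 2 * N) * secRho D N) * cy := by ring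
  rw [e, h]; ring

/-- THE k-GRADIENT OF ANY MEMBER IS A `t–t′` GRADIENT: with `x = sin²(kx/2)`, `y = sin²(ky/2)`,
`[(4D + 16N y)·sin(kx/2)cos(kx/2)]² + [(4D + 16N x)·sin(ky/2)cos(ky/2)]² = (D + 2N)²·ttpGradSqUV ρ (cos kx) (cos ky)` — everywhere, not
only on a contour. [folklore] -/
theorem secGradSq_eq {D N : ℝ} (kx ky : ℝ) (hT : D + 2 * N ≠ 0) :
    ((4 * D + 16 * N * Real.sin (ky / 2) ^ 2) * (Real.sin (kx / 2) * Real.cos (kx / 2))) ^ 2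
      + ((4 * D + 16 * N * Real.sin (kx / 2) ^ 2) * (Real.sin (ky / 2) * Real.cos (ky / 2))) ^ 2
      = (D + 2 * N) ^ 2 * ttpGradSqUV (secRho D N) (Real.cos kx) (Real.cos ky) := by
  have hx : Real.sin (kx / 2) ^ 2 = (1 - Real.cos kx) / 2 := by
    rw [Literature.Probability.LatticeModels.cos_eq_one_sub_two_mul_sin_half_sq kx]; ring
  have hy : Real.sin (ky / 2) ^ 2 = (1 - Real.cos ky) / 2 := by
    rw [Literature.Probability.LatticeModels.cos_eq_one_sub_two_mul_sin_half_sq ky]; ring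
  have ex : (Real.sin (kx / 2) * Real.cos (kx / 2)) ^ 2 = (1 - Real.cos kx ^ 2) / 4 := by
    rw [sin_half_mul_cos_half_sq kx, hx]; ring
  have ey : (Real.sin (ky / 2) * Real.cos (ky / 2)) ^ 2 = (1 - Real.cos ky ^ 2) / 4 := by
    rw [sin_half_mul_cos_half_sq ky, hy]; ring
  have e1 : ((4 * D + 16 * N * Real.sin (ky / 2) ^ 2) * (Real.sin (kx / 2) * Real.cos (kx / 2))) ^ 2
      = (4 * D + 16 * N * Real.sin (ky / 2) ^ 2) ^ 2 * (Real.sin (kx / 2) * Real.cos (kx / 2)) ^ 2 := mul_pow _ _ _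
  have e2 : ((4 * D + 16 * N * Real.sin (kx / 2) ^ 2) * (Real.sin (ky / 2) * Real.cos (ky / 2))) ^ 2
      = (4 * D + 16 * N * Real.sin (kx / 2) ^ 2) ^ 2 * (Real.sin (ky / 2) * Real.cos (ky / 2)) ^ 2 := mul_pow _ _ _
  rw [e1, e2, ex, ey, hx, hy, gradFactor_eq (Real.cos kx) hT, gradFactor_eq (Real.cos ky) hT]
  unfold ttpGradSqUV
  ring

/-- IMPLICIT (BRANCH) VELOCITY along `kx`, for ANY model of the family with differentiable energy-dependent coefficients: if
`e(k)` is a differentiable band branch, i.e. `secBilin (A (e k)) (D (e k)) (N (e k)) (sin²(k/2)) y = 0` for `k` near `kx`, then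
`e′·W = (4D + 16N·y)·sin(kx/2)cos(kx/2)` with `W = secBilin A′ D′ N′ x y` the energy derivative of the secular function at the point.
[folklore] -/
theorem branch_velocity_kx {A D N e : ℝ → ℝ} {A' D' N' e' : ℝ} {kx : ℝ} (y : ℝ)
    (hA : HasDerivAt A A' (e kx)) (hD : HasDerivAt D D' (e kx)) (hN : HasDerivAt N N' (e kx)) (he : HasDerivAt e e' kx)
    (hF : ∀ᶠ k in nhds kx, secBilin (A (e k)) (D (e k)) (N (e k)) (Real.sin (k / 2) ^ 2) y = 0) :
    e' * secBilin A' D' N' (Real.sin (kx / 2) ^ 2) y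
      = (4 * D (e kx) + 16 * N (e kx) * y) * (Real.sin (kx / 2) * Real.cos (kx / 2)) := by
  have hX : HasDerivAt (fun k => Real.sin (k / 2) ^ 2) (Real.sin (kx / 2) * Real.cos (kx / 2)) kx := hasDerivAt_halfSq' kx
  have hAe : HasDerivAt (fun k => A (e k)) (A' * e') kx := hA.comp kx he
  have hDe : HasDerivAt (fun k => D (e k)) (D' * e') kx := hD.comp kx he
  have hNe : HasDerivAt (fun k => N (e k)) (N' * e') kx := hN.comp kx he
  -- derivative of the composite secular function
  have h1 := (hDe.mul (hX.add_const y)).const_mul 4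
  have h2 := (hNe.mul (hX.mul_const y)).const_mul 16
  have h := (hAe.sub h1).sub h2
  have hG : HasDerivAt (fun k => secBilin (A (e k)) (D (e k)) (N (e k)) (Real.sin (k / 2) ^ 2) y)
      (A' * e' - 4 * (D' * e' * (Real.sin (kx / 2) ^ 2 + y) + D (e kx) * (Real.sin (kx / 2) * Real.cos (kx / 2)))
        - 16 * (N' * e' * (Real.sin (kx / 2) ^ 2 * y) + N (e kx) * (Real.sin (kx / 2) * Real.cos (kx / 2) * y))) kx := by
    refine h.congr_of_eventuallyEq ?_
    exact Filter.Eventually.of_forall fun k => by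
      simp only [secBilin, Pi.sub_apply, Pi.mul_apply]; ring
  -- the composite is eventually zero, so its derivative vanishes
  have hG0 : HasDerivAt (fun k => secBilin (A (e k)) (D (e k)) (N (e k)) (Real.sin (k / 2) ^ 2) y) 0 kx :=
    (hasDerivAt_const kx (0 : ℝ)).congr_of_eventuallyEq hF
  have huniq := hG.unique hG0
  unfold secBilin
  linarith [huniq]

/-- The same along `ky` at fixed `x` (symmetry of the family). [folklore] -/
theorem branch_velocity_ky {A D N e : ℝ → ℝ} {A' D' N' e' : ℝ} {ky : ℝ} (x : ℝ)
    (hA : HasDerivAt A A' (e ky)) (hD : HasDerivAt D D' (e ky)) (hN : HasDerivAt N N' (e ky)) (he : HasDerivAt e e' ky)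
    (hF : ∀ᶠ k in nhds ky, secBilin (A (e k)) (D (e k)) (N (e k)) x (Real.sin (k / 2) ^ 2) = 0) :
    e' * secBilin A' D' N' x (Real.sin (ky / 2) ^ 2)
      = (4 * D (e ky) + 16 * N (e ky) * x) * (Real.sin (ky / 2) * Real.cos (ky / 2)) := by
  have hF' : ∀ᶠ k in nhds ky, secBilin (A (e k)) (D (e k)) (N (e k)) (Real.sin (k / 2) ^ 2) x = 0 := by
    filter_upwards [hF] with k hk; rwa [secBilin_comm]
  rw [secBilin_comm]
  exact branch_velocity_kx x hA hD hN he hF'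

/-! ## §3 The form-defect law -/

/-- ON ONE CONTOUR THE OSCULATING SHAPE IS THE CONTOUR SHAPE: if the node `(x_n, x_n)`, `x_n = (1 − u)/2`, and the antinode `(1, y_a)`,
`y_a = (1 − v)/2`, lie on the same contour of a member with `D + 2N ≠ 0` and `rhoD u v ≠ 0`, then `ttpRho u v = secRho D N`.
[folklore] -/
theorem ttpRho_eq_secRho {A D N u v : ℝ} (hT : D + 2 * N ≠ 0) (hρ : rhoD u v ≠ 0)
    (hn : secBilin A D N ((1 - u) / 2) ((1 - u) / 2) = 0) (ha : secBilin A D N 1 ((1 - v) / 2) = 0) :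
    ttpRho u v = secRho D N := by
  symm
  apply ttpRho_unique hρ
  rw [secBilin_eq_ttpUV _ _ _ hT] at hn ha
  have e1 : (1 : ℝ) - 2 * ((1 - u) / 2) = u := by ring
  have e2 : (1 : ℝ) - 2 * 1 = -1 := by norm_num
  have e3 : (1 : ℝ) - 2 * ((1 - v) / 2) = v := by ring
  rw [e1] at hn
  rw [e2, e3] at ha
  have := mul_left_cancel₀ hT (show (D + 2 * N) * ttpUV (secRho D N) u u = (D + 2 * N) * ttpUV (secRho D N) (-1) v by
    linarith)
  exact this

/-- **THE FORM-DEFECT LAW.** Node `u` and antinode `v` on one contour of a member (`D + 2N ≠ 0`, `rhoD u v ≠ 0`); squared velocities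
of the band there of the implicit form delivered by §2, `vn2 = ((D + 2N)/W_n)²·ttpGradSqUV ρ u u` and `va2 = ((D + 2N)/W_a)²·
ttpGradSqUV ρ (−1) v` (`ρ = secRho D N`; `W_n, W_a` the energy derivatives of the secular function at the two points). Then with
`ρ′ = ttpRho u v` (the direct one-band construction of `OneBandInPlaneFormDefect`):
`vn2·ttpGradSqUV ρ′ (−1) v·W_n² = va2·ttpGradSqUV ρ′ u u·W_a²`, i.e. `t_node²·W_n² = t_an²·W_a²`: **`1 + δ = t_node/t_an = |W_a/W_n|`**.
[cite: AndersenEtAl1995, §6] -/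
theorem formDefect_law {A D N u v Wn Wa vn2 va2 : ℝ} (hT : D + 2 * N ≠ 0) (hρ : rhoD u v ≠ 0) (hWn : Wn ≠ 0) (hWa : Wa ≠ 0)
    (hn : secBilin A D N ((1 - u) / 2) ((1 - u) / 2) = 0) (ha : secBilin A D N 1 ((1 - v) / 2) = 0)
    (hvn : vn2 = ((D + 2 * N) / Wn) ^ 2 * ttpGradSqUV (secRho D N) u u)
    (hva : va2 = ((D + 2 * N) / Wa) ^ 2 * ttpGradSqUV (secRho D N) (-1) v) :
    vn2 * ttpGradSqUV (ttpRho u v) (-1) v * Wn ^ 2 = va2 * ttpGradSqUV (ttpRho u v) u u * Wa ^ 2 := by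
  rw [ttpRho_eq_secRho hT hρ hn ha, hvn, hva]
  field_simp

/-- Corollary in the matched-scale language of `OneBandInPlaneFormDefect`: if `t_n, t_a > 0` are the node- and antinode-matched scales
(`t_n²·ttpGradSqUV ρ′ u u = vn2`, `t_a²·ttpGradSqUV ρ′ (−1) v = va2`, form factors positive) then `t_n·|W_n| = t_a·|W_a|`
(`= |D + 2N|`): the form defect `t_n/t_a` equals `|W_a|/|W_n|`. [cite: AndersenEtAl1995, §6] -/
theorem formDefect_law_scales {A D N u v Wn Wa vn2 va2 tn ta : ℝ} (hT : D + 2 * N ≠ 0) (hρ : rhoD u v ≠ 0) (hWn : Wn ≠ 0)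
    (hWa : Wa ≠ 0) (hn : secBilin A D N ((1 - u) / 2) ((1 - u) / 2) = 0) (ha : secBilin A D N 1 ((1 - v) / 2) = 0)
    (hvn : vn2 = ((D + 2 * N) / Wn) ^ 2 * ttpGradSqUV (secRho D N) u u)
    (hva : va2 = ((D + 2 * N) / Wa) ^ 2 * ttpGradSqUV (secRho D N) (-1) v)
    (hFn : 0 < ttpGradSqUV (ttpRho u v) u u) (hFa : 0 < ttpGradSqUV (ttpRho u v) (-1) v)
    (htn : 0 < tn) (hta : 0 < ta) (htn2 : tn ^ 2 * ttpGradSqUV (ttpRho u v) u u = vn2)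
    (hta2 : ta ^ 2 * ttpGradSqUV (ttpRho u v) (-1) v = va2) :
    tn * |Wn| = ta * |Wa| := by
  have hlaw := formDefect_law hT hρ hWn hWa hn ha hvn hva
  rw [← htn2, ← hta2] at hlaw
  -- tn² Fn Fa Wn² = ta² Fa Fn Wa²  ⇒ (tn Wn)² = (ta Wa)²
  have hsq : (tn * |Wn|) ^ 2 = (ta * |Wa|) ^ 2 := by
    rw [mul_pow, mul_pow, sq_abs, sq_abs]
    have hF : ttpGradSqUV (ttpRho u v) u u * ttpGradSqUV (ttpRho u v) (-1) v ≠ 0 := by positivity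
    apply mul_left_cancel₀ hF
    linear_combination hlaw
  have h1 : 0 ≤ tn * |Wn| := by positivity
  have h2 : 0 ≤ ta * |Wa| := by positivity
  exact (pow_left_inj₀ h1 h2 two_ne_zero).mp hsq

/-! ## §4 σ instance: the Taylor coefficient is the energy derivative -/

/-- `d cA/dε = dcA`. [folklore] -/
theorem hasDerivAt_cA (Δ ε : ℝ) : HasDerivAt (fun e => cA Δ e) (dcA Δ ε) ε := by
  have h : (fun e => cA Δ e) = fun e => e * (Δ + e) ^ 2 := by funext e; rfl
  rw [h]
  have := (hasDerivAt_id' ε).mul (((hasDerivAt_id' ε).const_add Δ).pow 2)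
  refine this.congr_deriv ?_
  unfold dcA; simp; ring

/-- `d fsD/dε = dfsD`. [folklore] -/
theorem hasDerivAt_fsD (Δ tpd c ε : ℝ) : HasDerivAt (fun e => fsD Δ tpd c e) (dfsD Δ tpd c ε) ε := by
  have h : (fun e => fsD Δ tpd c e) = fun e => (Δ + e) * (tpd ^ 2 - c * e) := by funext e; rfl
  rw [h]
  have := ((hasDerivAt_id' ε).const_add Δ).mul (((hasDerivAt_id' ε).const_mul c).const_sub (tpd ^ 2))
  refine this.congr_deriv ?_
  unfold dfsD; simp; ring

/-- `d fsN/dε = dfsN`. [folklore] -/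
theorem hasDerivAt_fsN (tpd tpp c ε : ℝ) : HasDerivAt (fun e => fsN tpd tpp c e) (dfsN tpp c) ε := by
  have h : (fun e => fsN tpd tpp c e) = fun e => 2 * tpd ^ 2 * (c + tpp) + e * (tpp ^ 2 - c ^ 2) := by funext e; rfl
  rw [h]
  have := ((hasDerivAt_id' ε).mul_const (tpp ^ 2 - c ^ 2)).const_add (2 * tpd ^ 2 * (c + tpp))
  refine this.congr_deriv ?_
  unfold dfsN; simp

/-- THE σ SECULAR CUBIC IS DIFFERENTIABLE IN THE ENERGY WITH DERIVATIVE `dcharCubic` (so §2–§3 apply with `W = dcharCubic`).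
[folklore] -/
theorem hasDerivAt_charCubic_eps (Δ tpd tpp c x y ε : ℝ) :
    HasDerivAt (fun e => charCubic Δ tpd tpp c x y e) (dcharCubic Δ tpd tpp c x y ε) ε := by
  have h : (fun e => charCubic Δ tpd tpp c x y e) = fun e => cA Δ e - 4 * fsD Δ tpd c e * (x + y) - 16 * fsN tpd tpp c e * (x * y) := by
    funext e; rw [charCubic_bilinear]
  rw [h]
  have := ((hasDerivAt_cA Δ ε).sub (((hasDerivAt_fsD Δ tpd c ε).const_mul 4).mul_const (x + y))).sub
    (((hasDerivAt_fsN tpd tpp c ε).const_mul 16).mul_const (x * y))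
  refine this.congr_deriv ?_
  unfold dcharCubic; ring

/-- σ ON-CONTOUR COEFFICIENTS AGREE: `secWA cA fsN dcA dfsN = dcharA`, `secWB fsD fsN dfsD dfsN = dcharB`. [folklore] -/
theorem secW_sigma (Δ tpd tpp c ε : ℝ) :
    secWA (cA Δ ε) (fsN tpd tpp c ε) (dcA Δ ε) (dfsN tpp c) = dcharA Δ tpd tpp c ε ∧
      secWB (fsD Δ tpd c ε) (fsN tpd tpp c ε) (dfsD Δ tpd c ε) (dfsN tpp c) = dcharB Δ tpd tpp c ε := by
  constructor
  · unfold secWA dcharA; ring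
  · unfold secWB dcharB; ring

end Summit.Ventures.CertifiedManyBodySolver.Downfold.Emery
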